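import Summits.Parity.GeneralizedHardyLittlewood.Theorems.PrimeLevelFamEdgeIdeaDeltasLayerTwist
import HarnessLib

/-!
# (LANDING NOTE typer ls-idea-typ-1 gen 4: lens-21 g11's landing-ready file `HOME/ls-idea-lens-21/g11/Deck_HedgeRange_landing_ready.lean`
# sha16 b76cb709dfde76b0 VERBATIM — already in the deck namespace `.HedgeRange`, imports deck 32 — plus one-line docstrings on the
# lemmas the gate's docstring lint named; kernel of record = HOME-only `Lens21G10.HedgeRange` 9f681a824c63b97a (E b31 / D b137 PASS).)
#
# Route `PrimeLevelFamEdge` — TYPED IDEA DELTAS, deck `…IdeaDeltasHedgeRange` (SUGGESTED LANDING NOTE, for the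
# typer to edit: lens-21 g10's `HOME/ls-idea-lens-21/g10/Sketch_L21g10_HedgeRange.lean` rev 2 sha16 9f681a824c63b97a
# VERBATIM from its `open` line to its last theorem, namespace `…Sketch.Lens21G10.HedgeRange` →
# `…Theorems.PrimeLevelFamEdgeIdeaDeltas.HedgeRange`, `import HarnessLib` added; crux idea K-L21-10
# `l21-layer-twist-chi-face` (tree af8881a90f0cc64b) v9.4 rider fold; critics D b137 PASS LOW located (l.3111) and
# E b31 PASS / ACCEPTED, FIX 0 · STRIKE 0 (l.3118; E byte-copy farm rc 0, axioms std, owner's plant rc 1); imports deck 32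
# only; E's W-R⋆ paragraph rev 4.8 039a5268c2ba4c10 cites `chiFaceLLIO_mono` / `dualExponent*` as HOME-only kernel decls
# «cite by sha, or ask typ-1 to land --supports stmt-Parity-20343 --as helper first» — this file is that landing, prepared
# by the owner (lens-21 g11); a discretionary RECORD landing, value LOW: it changes no placement and no disposition.)
#
# Lens-21 g10 — the χ-face hedge's live conductor range and strip constant are ARGUMENTS of deck 32's
`ChiFaceLL`, not new objects (owner's typed anchor for K-L21-10 v9.4 after lens-5 g20's Burgess rider)

Cell ls-idea, seat ls-idea-lens-21 (planner-ls-idea-lens-21-g10-0, gen 10; lens `barrier`; owner of K-L21-10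
`l21-layer-twist-chi-face`, deck 32 `…IdeaDeltas.LayerTwist`). Pencil of record (HOME/ls-idea-lens-21/g10/
L21-g10-burgess-owner-check.md): Burgess of order `r = 3` (valid for EVERY modulus) applied on the Poisson-dual
side of the free Petersson-layer sum funds the (S)-crown rows of conductor `d = N^ν`, `ν > 3η/4`, with a power
saving `N^{-(2ν/9 - η/6) + ε}` per zero, summable over the family by the tree's PROVED log-free density under
`2ηc_D < 1`; the direct side with `r = 2` gives `ν > 4η/5` (lens-5 g20). Hence the hedge the line consumes is
`ChiFaceLLIO C' s η'` with `η' = 3η/4 + ε ≤ η` and `C' = (deg P + 1)/(1 − 4η'c_D) ≤ C` — the SAME Props at smaller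
arguments. The four lemmas below are the whole typed content of that remark: `ChiFaceLL`/`ChiFaceLLIO`/`ChiFaceLLEv`
are monotone (weaker) under `η ↦ η' ≤ η` (for `1 ≤ N`) and `C ↦ C' ≤ C` (for `e ≤ N`, where `log log N ≥ 0`).

HONESTY: bookkeeping lemmas about Props lens-21 defined; Burgess's theorem is NOT in the tree and is not stated
here; nothing about U, (S), R⋆, hR or `stub_offDiagBelowSlack_io` is bounded; `ChiFaceLLIO` stays OPEN in world ∅;
no exceptional-zero theorem (no Landau–Siegel / Siegel-zero exclusion, no Theorem 1–2 of arXiv:2211.02515, no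
repaired Margin232), no K_A/K_B and no summit statement is proved by this file; typed ≠ proved.
-/

namespace Summit.Parity.GeneralizedHardyLittlewood.Theorems.PrimeLevelFamEdgeIdeaDeltas.HedgeRange

open Summit.Parity.GeneralizedHardyLittlewood.Theorems.PrimeLevelFamEdgeIdeaDeltas.LayerTwist

/-- Fewer conductors is a weaker face: `η' ≤ η`, `1 ≤ N`. -/
theorem chiFaceLL_mono_eta {C s η η' N : ℝ} (hη : η' ≤ η) (hN : 1 ≤ N)
    (h : ChiFaceLL C s η N) : ChiFaceLL C s η' N := by
  intro d _ χ hd1 hdN ρ hρ him hre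
  exact h d χ hd1 (hdN.trans (Real.rpow_le_rpow_of_exponent_le hN hη)) ρ hρ him hre

/-- A narrower strip is a weaker face: `C' ≤ C`, `e ≤ N` (so that `log log N / log N ≥ 0`). -/
theorem chiFaceLL_mono_C {C C' s η N : ℝ} (hC : C' ≤ C) (hN : Real.exp 1 ≤ N)
    (h : ChiFaceLL C s η N) : ChiFaceLL C' s η N := by
  intro d _ χ hd1 hdN ρ hρ him hre
  have h1 := h d χ hd1 hdN ρ hρ him hre
  have hlogN : 1 ≤ Real.log N := by
    have := Real.log_le_log (Real.exp_pos 1) hN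
    rwa [Real.log_exp] at this
  have hx : 0 ≤ Real.log (Real.log N) / Real.log N :=
    div_nonneg (Real.log_nonneg hlogN) (by linarith)
  have hCC : C' * (Real.log (Real.log N) / Real.log N) ≤ C * (Real.log (Real.log N) / Real.log N) :=
    mul_le_mul_of_nonneg_right hC hx
  linarith

/-- Both parameters at once (`e ≤ N`). -/
theorem chiFaceLL_mono {C C' s η η' N : ℝ} (hC : C' ≤ C) (hη : η' ≤ η) (hN : Real.exp 1 ≤ N)
    (h : ChiFaceLL C s η N) : ChiFaceLL C' s η' N := by
  have h1N : (1 : ℝ) ≤ N := le_trans (by have := Real.add_one_le_exp (1 : ℝ); linarith) hN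
  exact chiFaceLL_mono_C hC hN (chiFaceLL_mono_eta hη h1N h)

/-- The i.o. hedge is monotone in `(C, η)`: what the line consumes after the Burgess rider,
`ChiFaceLLIO C' s η'` with `C' ≤ C`, `η' ≤ η`, follows from the hedge of record `ChiFaceLLIO C s η`. -/
theorem chiFaceLLIO_mono {C C' s η η' : ℝ} (hC : C' ≤ C) (hη : η' ≤ η)
    (h : ChiFaceLLIO C s η) : ChiFaceLLIO C' s η' := by
  intro N₀
  obtain ⟨N, hN, hface⟩ := h (max N₀ (Real.exp 1))
  exact ⟨N, (le_max_left _ _).trans hN, chiFaceLL_mono hC hη ((le_max_right _ _).trans hN) hface⟩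

/-- The every-scale hedge is monotone in `(C, η)` likewise. -/
theorem chiFaceLLEv_mono {C C' s η η' : ℝ} (hC : C' ≤ C) (hη : η' ≤ η)
    (h : ChiFaceLLEv C s η) : ChiFaceLLEv C' s η' := by
  obtain ⟨N₀, hN₀⟩ := h
  refine ⟨max N₀ (Real.exp 1), fun N hN => ?_⟩
  exact chiFaceLL_mono hC hη ((le_max_right _ _).trans hN) (hN₀ N ((le_max_left _ _).trans hN))

/-! ## §2 (rev 2, gen g10) — the DUAL-side Burgess exponent: ring identities of the owner's check (2)

After Poisson summation in the free layer variable `c` (K-L21-10 item 5, twist-covariant), the layer sum of a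
primitive `χ*` mod `d = N^ν` equals `(τ(χ*)/d)·Σ_m χ̄*(m) ŵ(m/d)`, `|τ(χ*)/d| = d^{-1/2}`, with dual length
`M* ≍ d·V/R`, `R ≍ N^{η/2}`, `|ŵ| ≤ R·sup|f|`.  The trivial bound on the dual sum returns Pólya–Vinogradov
(exponent `0`, deck 32); Burgess of order `r` on the dual sum (Abel, factor `1+2V`) gives the ratio
`ρ_dual(r) = d^{-1/2}·(dV/R)^{1-1/r}·d^{(r+1)/(4r²)+ε}·(1+2V)` and hence the crown-unit exponent
`dualExponent η ν r = (η-ν)/2 - ν/2 + (1-1/r)(ν-η/2) + ν(r+1)/(4r²)` (ε dropped).  Burgess with `r ≤ 3` holds for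
EVERY modulus (Burgess 1963; Heath-Brown 2013 eq. (1)), so `r = 3` is available on all conductors: threshold `3η/4`.
The lemmas are RING IDENTITIES / sign facts about this exponent — they check the ARITHMETIC of the owner's check,
not the applicability of Burgess's theorem (NOT in the tree, not stated here).  `dual_nontrivial_iff_exponent_neg`
is the consistency check that REPLACES the owner's-check line «non-triviality needs M* ≥ d^{1/(2r)}» (ERRATUM
E-L21-g10-1): Burgess(`r`) on a sum of length `M*` is non-trivial iff `M* > d^{(r+1)/(4r)}`, i.e.
`ν - η/2 > ν(r+1)/(4r)`, which is the SAME condition as `dualExponent η ν r < 0` (as it must be, PV being the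
trivial dual bound). -/

/-- The dual-side crown exponent (ε dropped) as a function of `(η, ν, r)`. -/
noncomputable def dualExponent (η ν r : ℝ) : ℝ :=
  (η - ν) / 2 - ν / 2 + (1 - 1 / r) * (ν - η / 2) + ν * (r + 1) / (4 * r ^ 2)

/-- Closed form: `dualExponent η ν r = (1/r)·(η/2 − ν(3r−1)/(4r))`. -/
theorem dualExponent_eq {r : ℝ} (hr : r ≠ 0) (η ν : ℝ) :
    dualExponent η ν r = 1 / r * (η / 2 - ν * (3 * r - 1) / (4 * r)) := by
  unfold dualExponent
  field_simp
  ring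

/-- Threshold form: `dualExponent η ν r = ((3r−1)/(4r²))·(2rη/(3r−1) − ν)`. -/
theorem dualExponent_identity {r : ℝ} (hr : r ≠ 0) (h3 : 3 * r - 1 ≠ 0) (η ν : ℝ) :
    dualExponent η ν r = (3 * r - 1) / (4 * r ^ 2) * (2 * r * η / (3 * r - 1) - ν) := by
  have hcancel : (3 * r - 1) / (4 * r ^ 2) * (2 * r * η / (3 * r - 1)) = 2 * r * η / (4 * r ^ 2) := by
    rw [div_mul_div_comm, mul_comm (3 * r - 1) (2 * r * η), mul_div_mul_right _ _ h3]
  rw [mul_sub, hcancel, dualExponent_eq hr]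
  field_simp
  ring

/-- For `r > 1/3` (in particular every integer order `r ≥ 1`) the dual exponent is negative iff `ν > 2rη/(3r−1)`
(thresholds `1, 4/5, 3/4, 8/11, … ↓ 2/3`). -/
theorem dualExponent_neg_iff {r : ℝ} (hr : 0 < r) (h3 : 0 < 3 * r - 1) (η ν : ℝ) :
    dualExponent η ν r < 0 ↔ 2 * r * η / (3 * r - 1) < ν := by
  have hpos : 0 < (3 * r - 1) / (4 * r ^ 2) := div_pos h3 (by positivity)
  rw [dualExponent_identity hr.ne' h3.ne', mul_neg_iff]
  constructor
  · rintro (⟨_, h⟩ | ⟨h, _⟩)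
    · linarith
    · linarith
  · intro h
    exact Or.inl ⟨hpos, by linarith⟩

/-- `r = 2`: the dual exponent COINCIDES with the direct Burgess(2) exponent `η/4 − 5ν/16` of lens-5 g20
(`burgess_exponent` at `ε = 0`): no gain from dualising at order 2. -/
theorem dualExponent_two (η ν : ℝ) : dualExponent η ν 2 = η / 4 - 5 * ν / 16 := by
  unfold dualExponent
  ring

/-- `r = 3` (ANY modulus): `dualExponent η ν 3 = η/6 − 2ν/9`; negative iff `ν > 3η/4`; `= −η/18` at `ν = η`. -/
theorem dualExponent_three (η ν : ℝ) : dualExponent η ν 3 = η / 6 - 2 * ν / 9 := by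
  unfold dualExponent
  ring

/-- Bookkeeping lemma `dualExponent_three_neg_iff` (LANDING NOTE: docstring added by the typer; statement and proof are the seat's). -/
theorem dualExponent_three_neg_iff (η ν : ℝ) : dualExponent η ν 3 < 0 ↔ 3 * η / 4 < ν := by
  rw [dualExponent_three]
  constructor <;> intro h <;> linarith

/-- Bookkeeping lemma `dualExponent_three_top` (LANDING NOTE: docstring added by the typer; statement and proof are the seat's). -/
theorem dualExponent_three_top (η : ℝ) : dualExponent η η 3 = -(η / 18) := by
  rw [dualExponent_three]
  ring

/-- The dual threshold `2r/(3r−1)` is STRICTLY below the direct threshold `2r/(2r+1)` exactly for `r > 2`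
(`η > 0`): dualising pays from order 3 on, and `r = 3` is the last order valid for every modulus. -/
theorem dualThreshold_lt_directThreshold {η r : ℝ} (hη : 0 < η) (hr : 2 < r) :
    2 * r * η / (3 * r - 1) < 2 * r * η / (2 * r + 1) := by
  have h1 : 0 < 3 * r - 1 := by linarith
  have h2 : 0 < 2 * r + 1 := by linarith
  have hrη : 0 < r * η := mul_pos (by linarith) hη
  have hnum : 2 * r * η * (2 * r + 1) - (3 * r - 1) * (2 * r * η) < 0 := by
    nlinarith [mul_pos (sub_pos.mpr hr) hrη]
  have key : 2 * r * η / (3 * r - 1) - 2 * r * η / (2 * r + 1) < 0 := by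
    rw [div_sub_div _ _ h1.ne' h2.ne']
    exact div_neg_of_neg_of_pos hnum (mul_pos h1 h2)
  linarith

/-- The dual thresholds decrease to `2/3` (cube-free conductors, all `r`): `2/3 < 2r/(3r−1)` for `r > 1/3`. -/
theorem two_thirds_lt_dualThreshold {r : ℝ} (h3 : 0 < 3 * r - 1) : (2 : ℝ) / 3 < 2 * r / (3 * r - 1) := by
  rw [div_lt_div_iff₀ (by norm_num) h3]
  linarith

/-- **Consistency / ERRATUM E-L21-g10-1.** Burgess(`r`) on the dual sum (length exponent `ν − η/2` in base `N`,
conductor exponent `ν`) is non-trivial iff `ν(r+1)/(4r) < ν − η/2`; for `r > 1/3` this is EQUIVALENT to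
`dualExponent η ν r < 0`.  (So «M* ≥ d^{1/6} ⟺ ν ≥ 3η/5» in the owner's check §2 is struck; the binding and
correct condition at `r = 3` is `M* > d^{1/3} ⟺ ν > 3η/4`, the threshold itself.) -/
theorem dual_nontrivial_iff_exponent_neg {r : ℝ} (hr : 0 < r) (h3 : 0 < 3 * r - 1) (η ν : ℝ) :
    ν * (r + 1) / (4 * r) < ν - η / 2 ↔ dualExponent η ν r < 0 := by
  rw [dualExponent_neg_iff hr h3, div_lt_iff₀ (by positivity : (0 : ℝ) < 4 * r), div_lt_iff₀ h3]
  constructor <;> intro h <;> nlinarith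

end Summit.Parity.GeneralizedHardyLittlewood.Theorems.PrimeLevelFamEdgeIdeaDeltas.HedgeRange
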